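import Summits.QuantumFields.YangMills.Theorems.BalabanUVNodesN11BgRowGaugeSocketsGB
import Literature.MathematicalPhysics.QuantumFieldTheory.Balaban1983to89.Node00.LargeFieldBackgroundCoPOfRecordB

/-!
# DAG node N11 × K1 — WITNESS-AGNOSTIC SOCKETS FOR THE GUARD-FREE ROW P11 ROAD (R AND G LETTERS): for ANY admissible Stage-13 parameter `θ` with `θ.Rz = RzOfRecord`,
# `θ.τ9.M = L^a`, (C1) and the no-wrap letter `hsN` on the window runs and the numeric rows, ROW P11 `bg` on EVERY window run — NO `PartCompat₁₃`, NO `hcube`, NO witness —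
# so that the witness of record, the cR-lettered members and the coming z-witness (director-ym №218) are ONE application each

SIBLING MODULE (director-ym №365 (2), RENAME-AND-REDIRECT; dag-n11-w1 g6): this NEW file `…BalabanUVNodesN11BgRowGaugeSocketsOfPowMB` carries the RE-KEYED declarations of the residue module `…BalabanUVNodesN11BgRowGaugeSocketsOfPowM` under the SAME short names in the namespace `…Theorems.BalabanUVNodesN11BgRowGaugeSocketsOfPowMB` (new fully-qualified names ⇒ lint-clean); the old module is NOT touched and is RESIDUE after node00-def-R's seam edit (R556 attic later). Displayed [15] hypotheses are the ᴮ sentences of S1a-C ∕ S1b-2 at print's [II] (2.3) datum `bd := lamDatum F` with the (7) data clause a PARAMETER `Dat` and its window-indexed transfer `hDat` displayed (dischargeable at print's clause by `…SocketsGBPrint` §2); conclusions BYTE-IDENTICAL to the residue module's; proofs = ONE application each of `…N11BgRowGaugeSocketsGB` at `(UbgMSCoPOfRecordB, lamDatum F, ubgMSCoPOfRecordB_dichotomy, UbgOfRecord₁₃CoP_succ)`.  Imports avoid every residue module.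

HEADER — WORK-UNIT METADATA.  Cell `pub-ymgap`, YM-PLAN Track A (HUMAN RULING D-0062 ∕ D-0149 ∕ D-0154 width seats), seat `pub-ymgap-dag-n11-w5` (g3; WIDTH SEAT 5 on NODE n11
[B14]; R455 (A) self-located CLAIM-2 in this seat's own lineage p623895 → p626404 → p635999, cell INBOX l.38474, on director-ym №218 «FLAG №9 — K0a's all-numerics witness family
`theta13OfThm1CCMW` is COUPLING-BLIND; θ-generic engines untouched; downstream faces re-key by token-pass» l.38254 and plan g86's z-witness pen∕ETA line l.38303), route `BalabanUVNodes`
rev 29, item K1⁹ `StabilityBRunRowsAtRecordR13SepCoPHV` = stmt-QuantumFields-27364 (dag-lead KEY MAP v2; helper lane, `--kind proof --supports 27364 --as helper`, count-neutral).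
[III] = [Balaban1988Convergent], [I] = [Balaban1987RG1], [15] = [Balaban1985Variational], [6] = [Balaban1985RegularSpaces].  Over this seat's p623895 `…N11BgRowGaugeROfHcubeOmega` §4
(`stage13_bgAtDatumCoP_of_thm1RegSepCoP7M_of_thm1GaugeR_of_hcubeΩ`, the θ-generic Stage-13 reduction on the R letters, `hcube` a hypothesis), p635999 `…N11BgRowGaugeGOfHcubeOmega` §3
(its G twin, guard as an inner antecedent), dag-n11-w4 g4's p624439 `…N11BgRowOfPowM` §1 (`hcubeΩ_of_powM`: K0b's (1.12)-cube inclusion at every power-of-`L` basic cube from (C1)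
alone — the compatible-or-one-block dichotomy) and def-R ∕ node00-def-K0a's record API (`UbgOfRecord₁₃CoP_succ`, `suppOfRecord₁₃P`, `suppOfRecord₁₃SepCoP`, `BgProvisoΛ`).

WHY THIS FILE.  Every WITNESS-LEVEL file of the guard-free row-P11 road — dag-n21-c's Eʷ, this seat's p626404 (R letters) and p635999 §4–§6 (G letters) at θ₁₅ᶜᶜᴹᵂ(j; γ), the member
files p629786 ∕ p631153 at θ₁₅ᶜᶜᴹᵂ's re-lettered numerics — is keyed AT the `theta13OfThm1CCMW` family, which director-ym №218 retires as K1⁹'s ∃-witness (`Efl = logz = 0` by `rfl`: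
coupling-blind); the edition of record to come is a z-carrying family (`…CCMZ`, plan g86: DEF-1 g9's Z1∕Z2), and «downstream faces re-key by token-pass».  The θ-GENERIC reductions of
the road exist (p623895 §4 ∕ p635999 §3) but stop one step short: they carry `hcube` as a hypothesis and conclude at the level-`n` minimiser `UbgMSCoPOfRecord … n s 𝐖` behind
`0 < θ.ν.M₁`, while the consumers (def-R's `Provisos₁₃SepCoPH.bg` consequent, dag-n11-w1's `hbgs`∕`hob` binders) read def-R's record background `UbgOfRecord₁₃CoP F N θ p n` on the
support `suppOfRecord₁₃SepCoP F N θ p n` in `BgProvisoΛ` currency — the packaging p626404 performs ONLY at the witness.  This file does that packaging ONCE, θ-generically: `hcube`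
discharged by `hcubeΩ_of_powM` from `hMa : θ.τ9.M = F.L ^ a` and the window-run-indexed (C1) letter `hC1`, the level step by `UbgOfRecord₁₃CoP_succ` (level `0` vacuous: no scale
`1 ≤ j ≤ 0`), the support adapter by membership (`⟨regular support, separation, (7)-regularity⟩`).  Any witness family is then ONE application to its own letter lemmas (RECIPE
below); the z-witness instance is the same line over Z2's letter twins when they land.  dag-n11-w4 g4's p624439 §4
`bgSepAt_of_thm1ScaledSep_of_powM` is the sibling socket of chain 1 (ScaledSep letters, `UbgOfRecord₁₃` currency); these are chain 2's (the live GaugeR letters, dag-n07-e I.35893,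
and their guarded ports).

WHAT THIS FILE PROVES (4 theorems, 0 `def`, 0 `sorry`; the conclusions are p623895 §5 ∕ §6's TYPES with θ₁₅ᶜᶜᴹᵂ(j; γ) ↦ a generic `θ`).
§1 ★★★ `bgSepCoPAt_of_thm1GaugeR_of_powM` — R letters ((8) `VariationalThm1RegSepCoP7M`, (9) `VariationalThm1GaugeRegSepCoP7MR … θ.τ9.M c`, floor `hc : c ≤ θ.ν.M₁`): the (7)-guarded
separated row-P11 body at `UbgOfRecord₁₃CoP F N θ p n s 𝐖` on every window run.
§2 ★★★ `bgProvisoΛ_of_thm1GaugeR_of_powM` — the same in def-R's currency `BgProvisoΛ F N p.K (settingOfRecord₁₃ F N θ p) (θ.Rz p.K) θ.τ9.M n (suppOfRecord₁₃SepCoP F N θ p n)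
(UbgOfRecord₁₃CoP F N θ p n)` = the consequent of `Provisos₁₃SepCoPH.bg` WITHOUT its `PartCompat₁₃` antecedent, on every window run.
§3 ★★★ `bgSepCoPAt_of_thm1GaugeG_of_powM` · §4 ★★★ `bgProvisoΛ_of_thm1GaugeG_of_powM` — G letters ((8)-G `VariationalThm1RegSepCoP7MG F N Adm`, (9)-G `VariationalThm1GaugeRegSepCoP7MG F N
θ.τ9.M Adm`), the guard met on the window prefixes as `hadm`.
RECIPE (prose, no witness token in code — the file stays θ-generic under the chair's №9 criterion): p626404 §3's statement at the witness of record is §2 applied to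
`(admissible_…_of_le_half, rfl, the floor letter via ν.M₁ = L^j, h15, h15G, hnum_…, εreg_le_…, hcomp, hcompRev, hBα_…, htI_…, htMS_…, hsN_… hjm, τ9.M = L^j, hC1_…, 0 < M₁)` of
the family's numerics∕letters modules — ONE application; the z-witness instance (director-ym №218, plan g86 Z2) is the same line over Z2's letter twins.

HONEST FRAMING.  Helper lane of K1⁹; count-neutral PACKAGING of landed reductions BY NAME (one `cases`, one `rw`, applications); (8)∕(9) in R or G form, the numeric rows
`hnum ∕ ha₀ ∕ hcomp ∕ hcomp' ∕ hBα ∕ htI ∕ htMS`, (C1) `hC1`, the no-wrap letter `hsN`, the window, admissibility are DISPLAYED HYPOTHESES, inhabited at no θ here; NOT a witness,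
NOT a re-pin, NOT a statement about which θ carries the rows; nothing of Bałaban asserted or discharged; `Provisos₁₃SepCoPH.bg`'s type untouched; N11 ∕ N07 NOT discharged; K0⁷ (V19
of record) ∕ K1⁹ (v10, 0∕6) NOT closed, no registered stub touched; counts unmoved (typed 28∕28 · discharged 5∕27 · A 5∕28); no summit statement is proved by this seat.  R4 closes
only the conditional finite-𝕋⁴ rung `BalabanLadder.UV` of one programme at fixed `ε = L^{−K}` — NOT ℝ⁴, NOT OS, NOT a mass gap, NOT Clay.  No `sorry`, `axiom`, `def`, `instance`,
`notation`.
Sources (SHAPE ∕ bookkeeping only): [III] (2.1) p.254, (2.4)–(2.8) pp.255–256, (2.12)–(2.13) p.256, (2.18) p.257, (2.27)–(2.28) p.259, (2.34)–(2.41) p.261, Thm 1 p.262, p.257;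
[I] (0.1) p.251, Thm 1 p.259, (1.11)–(1.16) p.262; [15] (6)–(7) p.278, Thm 1 (8)–(9) p.279, (144)–(152) pp.300–301, Prop. 8 p.304, p.304 lines 1–2; [6] (1.3)–(1.9) p.77.
-/

noncomputable section

open MeasureTheory
open scoped Matrix.Norms.L2Operator

namespace Summit.QuantumFields.YangMills.Theorems.BalabanUVNodesN11BgRowGaugeSocketsOfPowMB

open Literature.MathematicalPhysics.QuantumFieldTheory.Balaban1983to89 Node00
open T4Continuum B14.Eq218Concrete B15DeterminingSets FlowStep FlowStepRuns B12RegularSpaces111 B14RegularSpaces234 B14Radii T4AxialGaugeSmallField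
open BalabanUVNodesN11BgRowGaugeSocketsGB

variable {F : T4Family} {N : ℕ} [NeZero N]

/-! ## §1–§2  R letters — the witness-agnostic guard-free road -/

section SocketsR

/-- **§1 ★★★ THE WITNESS-AGNOSTIC SOCKET, R LETTERS — THE (7)-GUARDED SEPARATED ROW P11 BODY AT def-R's RECORD BACKGROUND `UbgOfRecord₁₃CoP F N θ p n s 𝐖` ON EVERY WINDOW RUN
`(p, n ≤ p.K)`, NO `PartCompat₁₃`, NO `hcube`**: for ANY `θ : Stage13Params F N` admissible with `θ.Rz = RzOfRecord`, floor `hc : c ≤ θ.ν.M₁`, (8) `VariationalThm1RegSepCoP7M`,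
(9)-R `VariationalThm1GaugeRegSepCoP7MR … θ.τ9.M c`, the numeric rows on the window runs, `hMa : θ.τ9.M = F.L ^ a`, the window-run-indexed (C1) `hC1`, the no-wrap letter `hsN` and
`0 < θ.ν.M₁`.  Proof: level `0` vacuous; at level `n + 1`, `UbgOfRecord₁₃CoP_succ` + p623895 §4 with `hcube := hcubeΩ_of_powM …` (dag-n11-w4's «BG-ONEBLOCK» §1).  = p623895 §5's
TYPE with θ₁₅ᶜᶜᴹᵂ(j; γ) ↦ `θ`; p626404 §2 is its instance at the witness of record.  CONDITIONAL; nothing of Bałaban asserted.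
[cite: Balaban1985Variational, (6)–(7) p.278, Thm 1 (8)–(9) p.279, (144)–(152) pp.300–301, Prop. 8 p.304; Balaban1985RegularSpaces, (1.3)–(1.9) p.77; Balaban1988Convergent, Thm 1 p.262, (2.1) p.254, (2.4)–(2.8) pp.255–256, (2.12)–(2.13) p.256, (2.27)–(2.28) p.259, p.257; Balaban1987RG1, (0.1) p.251, Thm 1 p.259, (1.12) p.262] -/
theorem bgSepCoPAt_of_thm1GaugeR_of_powM (θ : Stage13Params F N) (hθ : θ.Admissible F N) (hRz : θ.Rz = RzOfRecord F N)
    {c a : ℕ} {B₃ B₃' a₀ a₁ : ℝ} (hc : c ≤ θ.ν.M₁) {Dat : TopData F N}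
    (h15 : VariationalThm1RegSepCoP7MGB F N (floorGuard F c) (lamDatum F) Dat B₃ a₀ a₁)
    (h15G : VariationalThm1GaugeRegSepCoP7MGB F N θ.τ9.M (floorGuard F c) (lamDatum F) Dat B₃ B₃' a₀ a₁)
    (hnum : ∀ (p : B12.RunParams) (n : ℕ), n ≤ p.K → Step.InInterval θ.γ n (gOfRecord₁₃ F N θ p) → ∀ m, m ≤ n →
      0 < θ.s2.cR * epsOfRecord θ.ν (gOfRecord₁₃ F N θ p) m ∧ θ.s2.cR * epsOfRecord θ.ν (gOfRecord₁₃ F N θ p) m ≤ a₁ ∧ B₃ * (θ.s2.cR * epsOfRecord θ.ν (gOfRecord₁₃ F N θ p) m) ≤ θ.ν.εreg)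
    (ha₀ : θ.ν.εreg ≤ a₀)
    (hcomp : ∀ (p : B12.RunParams) (n : ℕ), n ≤ p.K → Step.InInterval θ.γ n (gOfRecord₁₃ F N θ p) → ∀ m, m < n →
      θ.s2.cR * epsOfRecord θ.ν (gOfRecord₁₃ F N θ p) m ≤ 2 * (θ.s2.cR * epsOfRecord θ.ν (gOfRecord₁₃ F N θ p) (m + 1)))
    (hcomp' : ∀ (p : B12.RunParams) (n : ℕ), n ≤ p.K → Step.InInterval θ.γ n (gOfRecord₁₃ F N θ p) → ∀ m, m < n →
      θ.s2.cR * epsOfRecord θ.ν (gOfRecord₁₃ F N θ p) (m + 1) ≤ 2 * (θ.s2.cR * epsOfRecord θ.ν (gOfRecord₁₃ F N θ p) m))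
    (hBα : ∀ (p : B12.RunParams) (n : ℕ), n ≤ p.K → Step.InInterval θ.γ n (gOfRecord₁₃ F N θ p) → ∀ m, 1 ≤ m → m ≤ n →
      B₃ * (θ.s2.cR * epsOfRecord θ.ν (gOfRecord₁₃ F N θ p) m) ≤ (1 - θ.s2.βc) * (lfOfRecord₁₂ F N θ.toStage12Params).alpha0 (gOfRecord₁₃ F N θ p m))
    (htI : ∀ (p : B12.RunParams) (n : ℕ), n ≤ p.K → Step.InInterval θ.γ n (gOfRecord₁₃ F N θ p) → ∀ m, 1 ≤ m → m ≤ n →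
      B₃' * (θ.s2.cR * epsOfRecord θ.ν (gOfRecord₁₃ F N θ p) m) ≤ θ.s2.cB * (lfOfRecord₁₂ F N θ.toStage12Params).alpha0 (gOfRecord₁₃ F N θ p m))
    (htMS : ∀ (p : B12.RunParams) (n : ℕ), n ≤ p.K → Step.InInterval θ.γ n (gOfRecord₁₃ F N θ p) → ∀ m, 1 ≤ m → m ≤ n →
      B₃' * (θ.s2.cR * epsOfRecord θ.ν (gOfRecord₁₃ F N θ p) m) ≤ θ.s2.B * θ.s2.C * θ.s2.Mr * (lfOfRecord₁₂ F N θ.toStage12Params).alpha0 (gOfRecord₁₃ F N θ p m))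
    (hsN : ∀ (p : B12.RunParams) (n : ℕ), n ≤ p.K → ∀ n', 1 ≤ n' → n' ≤ n + 1 →
      ((B14.Eq213MaximalDomains.side (F.P p.K).L θ.τ9.M n' : ℕ) : ℤ) < (F.P p.K).sitesPerDir 0)
    (hMa : θ.τ9.M = F.L ^ a)
    (hC1 : ∀ (p : B12.RunParams) (n : ℕ), n ≤ p.K → Step.InInterval θ.γ n (gOfRecord₁₃ F N θ p) → ∀ j, 1 ≤ j → j ≤ n →
      ∃ t : ℕ, 0 < t ∧ RkOfRecord (F.P p.K).L θ.ν.r (gOfRecord₁₃ F N θ p j) = (F.P p.K).L * t)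
    (hM₁ : 0 < θ.ν.M₁)
    (hDat : ∀ (p : B12.RunParams) (n : ℕ) (s : SeqOfRecord F θ.ν θ.τ9.M (gOfRecord₁₃ F N θ p) p.K n) (δ : ℕ → ℝ) (W : MSField (F.P p.K) (SU N)),
      n ≤ p.K → Step.InInterval θ.γ n (gOfRecord₁₃ F N θ p) →
      Sect2.DataSmall7PTop (avOfRecord F N p.K) s.Ω (suppDomOfRecord F θ.ν p.K s.Ω) n δ W → Dat p.K s.Ω (suppDomOfRecord F θ.ν p.K s.Ω) n δ W) :
    ∀ (p : B12.RunParams) (n : ℕ), n ≤ p.K → Step.InInterval θ.γ n (gOfRecord₁₃ F N θ p) →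
      ∀ s : SeqOfRecord F θ.ν θ.τ9.M (gOfRecord₁₃ F N θ p) p.K n, Sect2.SeqSeparated θ.ν.M₁ s →
      ∀ W : MSField (F.P p.K) (SU N), W ∈ suppOfRecord₁₃P F N θ p n s →
      Sect2.DataSmall7PTop (avOfRecord F N p.K) s.Ω (suppDomOfRecord F θ.ν p.K s.Ω) n (fun j' => θ.s2.cR * epsOfRecord θ.ν (gOfRecord₁₃ F N θ p) j') W →
      ∀ j', 1 ≤ j' → j' ≤ n → ∀ X : (Sect2.domSys (F.P p.K) θ.τ9.M j').Dom,
      (Sect2.domSites (F.P p.K) θ.τ9.M j' X ⊆ s.Λ j' →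
        Sect2.ofBackgroundC (settingOfRecord₁₃ F N θ p).ι (UbgOfRecord₁₃CoP F N θ p n s W) ∈
          Sect2.spaceI (settingOfRecord₁₃ F N θ p) (θ.Rz p.K) θ.τ9.M j' (Sect2.domSites (F.P p.K) θ.τ9.M j' X)
            ((settingOfRecord₁₃ F N θ p).lf.alpha0 ((settingOfRecord₁₃ F N θ p).flow.g j')) ((settingOfRecord₁₃ F N θ p).lf.alpha1 ((settingOfRecord₁₃ F N θ p).flow.g j'))) ∧
      (Sect2.admB (F.P p.K) θ.ν θ.τ9.M (gOfRecord₁₃ F N θ p) s.Ω s.Λ j' (Sect2.domSites (F.P p.K) θ.τ9.M j' X) = true →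
        Sect2.ofBackgroundC (settingOfRecord₁₃ F N θ p).ι (UbgOfRecord₁₃CoP F N θ p n s W) ∈
          Sect2.spaceMS (settingOfRecord₁₃ F N θ p) (θ.Rz p.K) θ.τ9.M j' (Sect2.domSites (F.P p.K) θ.τ9.M j' X) s.Ω) :=
  fun p n hn hw s hsep W hW h7 => bgSepCoPAt_of_thm1RegSepCoP7MGB_of_thm1GaugeGB_of_hseam_of_powM θ hθ hRz h15 h15G
    (fun p n => UbgMSCoPOfRecordB F N θ.ν θ.τ9.M (gOfRecord₁₃ F N θ p) p.K n)
    (fun p n s W => ubgMSCoPOfRecordB_dichotomy θ.ν θ.τ9.M (gOfRecord₁₃ F N θ p) p.K n s W) (fun p n => UbgOfRecord₁₃CoP_succ F N θ p n) hnum ha₀ hcomp hcomp' hBα htI htMS hsN hMa hC1 hM₁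
    (fun _ _ _ _ _ => hc) p n hn hw s hsep W hW (hDat p n s _ W hn hw h7)

/-- **§2 ★★★ THE WITNESS-AGNOSTIC SOCKET IN def-R's CURRENCY, R LETTERS — ROW P11 `BgProvisoΛ F N p.K (settingOfRecord₁₃ F N θ p) (θ.Rz p.K) θ.τ9.M n (suppOfRecord₁₃SepCoP F N θ p n)
(UbgOfRecord₁₃CoP F N θ p n)` ON EVERY WINDOW RUN** — the exact consequent of def-R's `Provisos₁₃SepCoPH.bg` with its `PartCompat₁₃ F N θ p n` antecedent GONE, and the TYPE of
dag-n11-w1's `hbg(s)`∕`hob` binders at a generic θ; from §1 through K0a's support adapter (membership in `suppOfRecord₁₃SepCoP` = ⟨regular support, separation, (7)-regularity⟩).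
= p623895 §6's TYPE with θ₁₅ᶜᶜᴹᵂ(j; γ) ↦ `θ`; p626404 §3 is its instance (one application, RECIPE in the header).  CONDITIONAL; nothing of Bałaban asserted.
[cite: Balaban1988Convergent, (2.28) p.259, (2.18) p.257, Thm 1 p.262, p.257; Balaban1985Variational, (6)–(7) p.278, Thm 1 (8)–(9) p.279; Balaban1985RegularSpaces, (1.3)–(1.6) p.77; Balaban1987RG1, (0.1) p.251, (1.12) p.262] -/
theorem bgProvisoΛ_of_thm1GaugeR_of_powM (θ : Stage13Params F N) (hθ : θ.Admissible F N) (hRz : θ.Rz = RzOfRecord F N)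
    {c a : ℕ} {B₃ B₃' a₀ a₁ : ℝ} (hc : c ≤ θ.ν.M₁) {Dat : TopData F N}
    (h15 : VariationalThm1RegSepCoP7MGB F N (floorGuard F c) (lamDatum F) Dat B₃ a₀ a₁)
    (h15G : VariationalThm1GaugeRegSepCoP7MGB F N θ.τ9.M (floorGuard F c) (lamDatum F) Dat B₃ B₃' a₀ a₁)
    (hnum : ∀ (p : B12.RunParams) (n : ℕ), n ≤ p.K → Step.InInterval θ.γ n (gOfRecord₁₃ F N θ p) → ∀ m, m ≤ n →
      0 < θ.s2.cR * epsOfRecord θ.ν (gOfRecord₁₃ F N θ p) m ∧ θ.s2.cR * epsOfRecord θ.ν (gOfRecord₁₃ F N θ p) m ≤ a₁ ∧ B₃ * (θ.s2.cR * epsOfRecord θ.ν (gOfRecord₁₃ F N θ p) m) ≤ θ.ν.εreg)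
    (ha₀ : θ.ν.εreg ≤ a₀)
    (hcomp : ∀ (p : B12.RunParams) (n : ℕ), n ≤ p.K → Step.InInterval θ.γ n (gOfRecord₁₃ F N θ p) → ∀ m, m < n →
      θ.s2.cR * epsOfRecord θ.ν (gOfRecord₁₃ F N θ p) m ≤ 2 * (θ.s2.cR * epsOfRecord θ.ν (gOfRecord₁₃ F N θ p) (m + 1)))
    (hcomp' : ∀ (p : B12.RunParams) (n : ℕ), n ≤ p.K → Step.InInterval θ.γ n (gOfRecord₁₃ F N θ p) → ∀ m, m < n →
      θ.s2.cR * epsOfRecord θ.ν (gOfRecord₁₃ F N θ p) (m + 1) ≤ 2 * (θ.s2.cR * epsOfRecord θ.ν (gOfRecord₁₃ F N θ p) m))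
    (hBα : ∀ (p : B12.RunParams) (n : ℕ), n ≤ p.K → Step.InInterval θ.γ n (gOfRecord₁₃ F N θ p) → ∀ m, 1 ≤ m → m ≤ n →
      B₃ * (θ.s2.cR * epsOfRecord θ.ν (gOfRecord₁₃ F N θ p) m) ≤ (1 - θ.s2.βc) * (lfOfRecord₁₂ F N θ.toStage12Params).alpha0 (gOfRecord₁₃ F N θ p m))
    (htI : ∀ (p : B12.RunParams) (n : ℕ), n ≤ p.K → Step.InInterval θ.γ n (gOfRecord₁₃ F N θ p) → ∀ m, 1 ≤ m → m ≤ n →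
      B₃' * (θ.s2.cR * epsOfRecord θ.ν (gOfRecord₁₃ F N θ p) m) ≤ θ.s2.cB * (lfOfRecord₁₂ F N θ.toStage12Params).alpha0 (gOfRecord₁₃ F N θ p m))
    (htMS : ∀ (p : B12.RunParams) (n : ℕ), n ≤ p.K → Step.InInterval θ.γ n (gOfRecord₁₃ F N θ p) → ∀ m, 1 ≤ m → m ≤ n →
      B₃' * (θ.s2.cR * epsOfRecord θ.ν (gOfRecord₁₃ F N θ p) m) ≤ θ.s2.B * θ.s2.C * θ.s2.Mr * (lfOfRecord₁₂ F N θ.toStage12Params).alpha0 (gOfRecord₁₃ F N θ p m))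
    (hsN : ∀ (p : B12.RunParams) (n : ℕ), n ≤ p.K → ∀ n', 1 ≤ n' → n' ≤ n + 1 →
      ((B14.Eq213MaximalDomains.side (F.P p.K).L θ.τ9.M n' : ℕ) : ℤ) < (F.P p.K).sitesPerDir 0)
    (hMa : θ.τ9.M = F.L ^ a)
    (hC1 : ∀ (p : B12.RunParams) (n : ℕ), n ≤ p.K → Step.InInterval θ.γ n (gOfRecord₁₃ F N θ p) → ∀ j, 1 ≤ j → j ≤ n →
      ∃ t : ℕ, 0 < t ∧ RkOfRecord (F.P p.K).L θ.ν.r (gOfRecord₁₃ F N θ p j) = (F.P p.K).L * t)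
    (hM₁ : 0 < θ.ν.M₁)
    (hDat : ∀ (p : B12.RunParams) (n : ℕ) (s : SeqOfRecord F θ.ν θ.τ9.M (gOfRecord₁₃ F N θ p) p.K n) (δ : ℕ → ℝ) (W : MSField (F.P p.K) (SU N)),
      n ≤ p.K → Step.InInterval θ.γ n (gOfRecord₁₃ F N θ p) →
      Sect2.DataSmall7PTop (avOfRecord F N p.K) s.Ω (suppDomOfRecord F θ.ν p.K s.Ω) n δ W → Dat p.K s.Ω (suppDomOfRecord F θ.ν p.K s.Ω) n δ W) :
    ∀ (p : B12.RunParams) (n : ℕ), n ≤ p.K → Step.InInterval θ.γ n (gOfRecord₁₃ F N θ p) →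
      BgProvisoΛ F N p.K (settingOfRecord₁₃ F N θ p) (θ.Rz p.K) θ.τ9.M n
        (suppOfRecord₁₃SepCoP F N θ p n) (UbgOfRecord₁₃CoP F N θ p n) :=
  bgProvisoΛ_of_thm1RegSepCoP7MGB_of_thm1GaugeGB_of_hseam_of_powM θ hθ hRz h15 h15G
    (fun p n => UbgMSCoPOfRecordB F N θ.ν θ.τ9.M (gOfRecord₁₃ F N θ p) p.K n)
    (fun p n s W => ubgMSCoPOfRecordB_dichotomy θ.ν θ.τ9.M (gOfRecord₁₃ F N θ p) p.K n s W) (fun p n => UbgOfRecord₁₃CoP_succ F N θ p n) hnum ha₀ hcomp hcomp' hBα htI htMS hsN hMa hC1 hM₁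
    (fun _ _ _ _ _ => hc) hDat

end SocketsR

/-! ## §3–§4  G letters — the same sockets on the guard-generic ports (49 §4 ∕ 54 §3), guard met on the window prefixes -/

section SocketsG

/-- **§3 ★★★ THE WITNESS-AGNOSTIC SOCKET, G LETTERS — THE (7)-GUARDED SEPARATED ROW P11 BODY AT `UbgOfRecord₁₃CoP F N θ p n s 𝐖` ON EVERY WINDOW RUN, NO `PartCompat₁₃`, NO `hcube`**:
§1 with (8) ↦ (8)-G `VariationalThm1RegSepCoP7MG F N Adm` (49 §4), (9)-R ↦ (9)-G `VariationalThm1GaugeRegSepCoP7MG F N θ.τ9.M Adm` (54 §3), the floor letter `hc` ↦ the guard met on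
the window prefixes `hadm : ∀ p n, n ≤ p.K → window → ∀ s, Adm θ.ν θ.τ9.M (gOfRecord₁₃ F N θ p) p.K n s`; proof through p635999 §3.  p635999 §4 is its instance at θ₁₅ᶜᶜᴹᵂ(j; γ);
for the plan's V20-G guard `fun ν _ _ K k _ => c ≤ ν.M₁ ∧ k + c₀ ≤ F.m + K`, `hadm` is `⟨c ≤ θ.ν.M₁, by omega⟩` from `c₀ ≤ F.m` (p635999 §6).  CONDITIONAL; nothing of Bałaban asserted.
[cite: Balaban1985Variational, (6)–(7) p.278, Thm 1 (8)–(9) p.279, Prop. 8 p.304, p.304 lines 1–2; Balaban1985RegularSpaces, (1.3)–(1.9) p.77; Balaban1988Convergent, Thm 1 p.262, (2.1) p.254, (2.4)–(2.8) pp.255–256, (2.28) p.259, p.257; Balaban1987RG1, (0.1) p.251, Thm 1 p.259, (1.12) p.262] -/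
theorem bgSepCoPAt_of_thm1GaugeG_of_powM (θ : Stage13Params F N) (hθ : θ.Admissible F N) (hRz : θ.Rz = RzOfRecord F N)
    {Adm : StepGuard F} {Dat : TopData F N} {a : ℕ} {B₃ B₃' a₀ a₁ : ℝ}
    (h15 : VariationalThm1RegSepCoP7MGB F N Adm (lamDatum F) Dat B₃ a₀ a₁) (h15G : VariationalThm1GaugeRegSepCoP7MGB F N θ.τ9.M Adm (lamDatum F) Dat B₃ B₃' a₀ a₁)
    (hnum : ∀ (p : B12.RunParams) (n : ℕ), n ≤ p.K → Step.InInterval θ.γ n (gOfRecord₁₃ F N θ p) → ∀ m, m ≤ n →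
      0 < θ.s2.cR * epsOfRecord θ.ν (gOfRecord₁₃ F N θ p) m ∧ θ.s2.cR * epsOfRecord θ.ν (gOfRecord₁₃ F N θ p) m ≤ a₁ ∧ B₃ * (θ.s2.cR * epsOfRecord θ.ν (gOfRecord₁₃ F N θ p) m) ≤ θ.ν.εreg)
    (ha₀ : θ.ν.εreg ≤ a₀)
    (hcomp : ∀ (p : B12.RunParams) (n : ℕ), n ≤ p.K → Step.InInterval θ.γ n (gOfRecord₁₃ F N θ p) → ∀ m, m < n →
      θ.s2.cR * epsOfRecord θ.ν (gOfRecord₁₃ F N θ p) m ≤ 2 * (θ.s2.cR * epsOfRecord θ.ν (gOfRecord₁₃ F N θ p) (m + 1)))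
    (hcomp' : ∀ (p : B12.RunParams) (n : ℕ), n ≤ p.K → Step.InInterval θ.γ n (gOfRecord₁₃ F N θ p) → ∀ m, m < n →
      θ.s2.cR * epsOfRecord θ.ν (gOfRecord₁₃ F N θ p) (m + 1) ≤ 2 * (θ.s2.cR * epsOfRecord θ.ν (gOfRecord₁₃ F N θ p) m))
    (hBα : ∀ (p : B12.RunParams) (n : ℕ), n ≤ p.K → Step.InInterval θ.γ n (gOfRecord₁₃ F N θ p) → ∀ m, 1 ≤ m → m ≤ n →
      B₃ * (θ.s2.cR * epsOfRecord θ.ν (gOfRecord₁₃ F N θ p) m) ≤ (1 - θ.s2.βc) * (lfOfRecord₁₂ F N θ.toStage12Params).alpha0 (gOfRecord₁₃ F N θ p m))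
    (htI : ∀ (p : B12.RunParams) (n : ℕ), n ≤ p.K → Step.InInterval θ.γ n (gOfRecord₁₃ F N θ p) → ∀ m, 1 ≤ m → m ≤ n →
      B₃' * (θ.s2.cR * epsOfRecord θ.ν (gOfRecord₁₃ F N θ p) m) ≤ θ.s2.cB * (lfOfRecord₁₂ F N θ.toStage12Params).alpha0 (gOfRecord₁₃ F N θ p m))
    (htMS : ∀ (p : B12.RunParams) (n : ℕ), n ≤ p.K → Step.InInterval θ.γ n (gOfRecord₁₃ F N θ p) → ∀ m, 1 ≤ m → m ≤ n →
      B₃' * (θ.s2.cR * epsOfRecord θ.ν (gOfRecord₁₃ F N θ p) m) ≤ θ.s2.B * θ.s2.C * θ.s2.Mr * (lfOfRecord₁₂ F N θ.toStage12Params).alpha0 (gOfRecord₁₃ F N θ p m))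
    (hsN : ∀ (p : B12.RunParams) (n : ℕ), n ≤ p.K → ∀ n', 1 ≤ n' → n' ≤ n + 1 →
      ((B14.Eq213MaximalDomains.side (F.P p.K).L θ.τ9.M n' : ℕ) : ℤ) < (F.P p.K).sitesPerDir 0)
    (hMa : θ.τ9.M = F.L ^ a)
    (hC1 : ∀ (p : B12.RunParams) (n : ℕ), n ≤ p.K → Step.InInterval θ.γ n (gOfRecord₁₃ F N θ p) → ∀ j, 1 ≤ j → j ≤ n →
      ∃ t : ℕ, 0 < t ∧ RkOfRecord (F.P p.K).L θ.ν.r (gOfRecord₁₃ F N θ p j) = (F.P p.K).L * t)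
    (hM₁ : 0 < θ.ν.M₁)
    (hadm : ∀ (p : B12.RunParams) (n : ℕ), n ≤ p.K → Step.InInterval θ.γ n (gOfRecord₁₃ F N θ p) →
      ∀ s : SeqOfRecord F θ.ν θ.τ9.M (gOfRecord₁₃ F N θ p) p.K n, Adm θ.ν θ.τ9.M (gOfRecord₁₃ F N θ p) p.K n s)
    (hDat : ∀ (p : B12.RunParams) (n : ℕ) (s : SeqOfRecord F θ.ν θ.τ9.M (gOfRecord₁₃ F N θ p) p.K n) (δ : ℕ → ℝ) (W : MSField (F.P p.K) (SU N)),
      n ≤ p.K → Step.InInterval θ.γ n (gOfRecord₁₃ F N θ p) →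
      Sect2.DataSmall7PTop (avOfRecord F N p.K) s.Ω (suppDomOfRecord F θ.ν p.K s.Ω) n δ W → Dat p.K s.Ω (suppDomOfRecord F θ.ν p.K s.Ω) n δ W) :
    ∀ (p : B12.RunParams) (n : ℕ), n ≤ p.K → Step.InInterval θ.γ n (gOfRecord₁₃ F N θ p) →
      ∀ s : SeqOfRecord F θ.ν θ.τ9.M (gOfRecord₁₃ F N θ p) p.K n, Sect2.SeqSeparated θ.ν.M₁ s →
      ∀ W : MSField (F.P p.K) (SU N), W ∈ suppOfRecord₁₃P F N θ p n s →
      Sect2.DataSmall7PTop (avOfRecord F N p.K) s.Ω (suppDomOfRecord F θ.ν p.K s.Ω) n (fun j' => θ.s2.cR * epsOfRecord θ.ν (gOfRecord₁₃ F N θ p) j') W →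
      ∀ j', 1 ≤ j' → j' ≤ n → ∀ X : (Sect2.domSys (F.P p.K) θ.τ9.M j').Dom,
      (Sect2.domSites (F.P p.K) θ.τ9.M j' X ⊆ s.Λ j' →
        Sect2.ofBackgroundC (settingOfRecord₁₃ F N θ p).ι (UbgOfRecord₁₃CoP F N θ p n s W) ∈
          Sect2.spaceI (settingOfRecord₁₃ F N θ p) (θ.Rz p.K) θ.τ9.M j' (Sect2.domSites (F.P p.K) θ.τ9.M j' X)
            ((settingOfRecord₁₃ F N θ p).lf.alpha0 ((settingOfRecord₁₃ F N θ p).flow.g j')) ((settingOfRecord₁₃ F N θ p).lf.alpha1 ((settingOfRecord₁₃ F N θ p).flow.g j'))) ∧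
      (Sect2.admB (F.P p.K) θ.ν θ.τ9.M (gOfRecord₁₃ F N θ p) s.Ω s.Λ j' (Sect2.domSites (F.P p.K) θ.τ9.M j' X) = true →
        Sect2.ofBackgroundC (settingOfRecord₁₃ F N θ p).ι (UbgOfRecord₁₃CoP F N θ p n s W) ∈
          Sect2.spaceMS (settingOfRecord₁₃ F N θ p) (θ.Rz p.K) θ.τ9.M j' (Sect2.domSites (F.P p.K) θ.τ9.M j' X) s.Ω) :=
  fun p n hn hw s hsep W hW h7 => bgSepCoPAt_of_thm1RegSepCoP7MGB_of_thm1GaugeGB_of_hseam_of_powM θ hθ hRz h15 h15G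
    (fun p n => UbgMSCoPOfRecordB F N θ.ν θ.τ9.M (gOfRecord₁₃ F N θ p) p.K n)
    (fun p n s W => ubgMSCoPOfRecordB_dichotomy θ.ν θ.τ9.M (gOfRecord₁₃ F N θ p) p.K n s W) (fun p n => UbgOfRecord₁₃CoP_succ F N θ p n) hnum ha₀ hcomp hcomp' hBα htI htMS hsN hMa hC1 hM₁
    hadm p n hn hw s hsep W hW (hDat p n s _ W hn hw h7)

/-- **§4 ★★★ THE WITNESS-AGNOSTIC SOCKET IN def-R's CURRENCY, G LETTERS — ROW P11 `BgProvisoΛ … (suppOfRecord₁₃SepCoP …) (UbgOfRecord₁₃CoP …)` ON EVERY WINDOW RUN** from §3 through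
K0a's support adapter; p635999 §5 is its instance at θ₁₅ᶜᶜᴹᵂ(j; γ).  CONDITIONAL; nothing of Bałaban asserted.
[cite: Balaban1988Convergent, (2.28) p.259, (2.18) p.257, Thm 1 p.262; Balaban1985Variational, (6)–(7) p.278, Thm 1 (8)–(9) p.279, p.304 lines 1–2; Balaban1985RegularSpaces, (1.3)–(1.6) p.77; Balaban1987RG1, (0.1) p.251, (1.12) p.262] -/
theorem bgProvisoΛ_of_thm1GaugeG_of_powM (θ : Stage13Params F N) (hθ : θ.Admissible F N) (hRz : θ.Rz = RzOfRecord F N)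
    {Adm : StepGuard F} {Dat : TopData F N} {a : ℕ} {B₃ B₃' a₀ a₁ : ℝ}
    (h15 : VariationalThm1RegSepCoP7MGB F N Adm (lamDatum F) Dat B₃ a₀ a₁) (h15G : VariationalThm1GaugeRegSepCoP7MGB F N θ.τ9.M Adm (lamDatum F) Dat B₃ B₃' a₀ a₁)
    (hnum : ∀ (p : B12.RunParams) (n : ℕ), n ≤ p.K → Step.InInterval θ.γ n (gOfRecord₁₃ F N θ p) → ∀ m, m ≤ n →
      0 < θ.s2.cR * epsOfRecord θ.ν (gOfRecord₁₃ F N θ p) m ∧ θ.s2.cR * epsOfRecord θ.ν (gOfRecord₁₃ F N θ p) m ≤ a₁ ∧ B₃ * (θ.s2.cR * epsOfRecord θ.ν (gOfRecord₁₃ F N θ p) m) ≤ θ.ν.εreg)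
    (ha₀ : θ.ν.εreg ≤ a₀)
    (hcomp : ∀ (p : B12.RunParams) (n : ℕ), n ≤ p.K → Step.InInterval θ.γ n (gOfRecord₁₃ F N θ p) → ∀ m, m < n →
      θ.s2.cR * epsOfRecord θ.ν (gOfRecord₁₃ F N θ p) m ≤ 2 * (θ.s2.cR * epsOfRecord θ.ν (gOfRecord₁₃ F N θ p) (m + 1)))
    (hcomp' : ∀ (p : B12.RunParams) (n : ℕ), n ≤ p.K → Step.InInterval θ.γ n (gOfRecord₁₃ F N θ p) → ∀ m, m < n →
      θ.s2.cR * epsOfRecord θ.ν (gOfRecord₁₃ F N θ p) (m + 1) ≤ 2 * (θ.s2.cR * epsOfRecord θ.ν (gOfRecord₁₃ F N θ p) m))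
    (hBα : ∀ (p : B12.RunParams) (n : ℕ), n ≤ p.K → Step.InInterval θ.γ n (gOfRecord₁₃ F N θ p) → ∀ m, 1 ≤ m → m ≤ n →
      B₃ * (θ.s2.cR * epsOfRecord θ.ν (gOfRecord₁₃ F N θ p) m) ≤ (1 - θ.s2.βc) * (lfOfRecord₁₂ F N θ.toStage12Params).alpha0 (gOfRecord₁₃ F N θ p m))
    (htI : ∀ (p : B12.RunParams) (n : ℕ), n ≤ p.K → Step.InInterval θ.γ n (gOfRecord₁₃ F N θ p) → ∀ m, 1 ≤ m → m ≤ n →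
      B₃' * (θ.s2.cR * epsOfRecord θ.ν (gOfRecord₁₃ F N θ p) m) ≤ θ.s2.cB * (lfOfRecord₁₂ F N θ.toStage12Params).alpha0 (gOfRecord₁₃ F N θ p m))
    (htMS : ∀ (p : B12.RunParams) (n : ℕ), n ≤ p.K → Step.InInterval θ.γ n (gOfRecord₁₃ F N θ p) → ∀ m, 1 ≤ m → m ≤ n →
      B₃' * (θ.s2.cR * epsOfRecord θ.ν (gOfRecord₁₃ F N θ p) m) ≤ θ.s2.B * θ.s2.C * θ.s2.Mr * (lfOfRecord₁₂ F N θ.toStage12Params).alpha0 (gOfRecord₁₃ F N θ p m))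
    (hsN : ∀ (p : B12.RunParams) (n : ℕ), n ≤ p.K → ∀ n', 1 ≤ n' → n' ≤ n + 1 →
      ((B14.Eq213MaximalDomains.side (F.P p.K).L θ.τ9.M n' : ℕ) : ℤ) < (F.P p.K).sitesPerDir 0)
    (hMa : θ.τ9.M = F.L ^ a)
    (hC1 : ∀ (p : B12.RunParams) (n : ℕ), n ≤ p.K → Step.InInterval θ.γ n (gOfRecord₁₃ F N θ p) → ∀ j, 1 ≤ j → j ≤ n →
      ∃ t : ℕ, 0 < t ∧ RkOfRecord (F.P p.K).L θ.ν.r (gOfRecord₁₃ F N θ p j) = (F.P p.K).L * t)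
    (hM₁ : 0 < θ.ν.M₁)
    (hadm : ∀ (p : B12.RunParams) (n : ℕ), n ≤ p.K → Step.InInterval θ.γ n (gOfRecord₁₃ F N θ p) →
      ∀ s : SeqOfRecord F θ.ν θ.τ9.M (gOfRecord₁₃ F N θ p) p.K n, Adm θ.ν θ.τ9.M (gOfRecord₁₃ F N θ p) p.K n s)
    (hDat : ∀ (p : B12.RunParams) (n : ℕ) (s : SeqOfRecord F θ.ν θ.τ9.M (gOfRecord₁₃ F N θ p) p.K n) (δ : ℕ → ℝ) (W : MSField (F.P p.K) (SU N)),
      n ≤ p.K → Step.InInterval θ.γ n (gOfRecord₁₃ F N θ p) →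
      Sect2.DataSmall7PTop (avOfRecord F N p.K) s.Ω (suppDomOfRecord F θ.ν p.K s.Ω) n δ W → Dat p.K s.Ω (suppDomOfRecord F θ.ν p.K s.Ω) n δ W) :
    ∀ (p : B12.RunParams) (n : ℕ), n ≤ p.K → Step.InInterval θ.γ n (gOfRecord₁₃ F N θ p) →
      BgProvisoΛ F N p.K (settingOfRecord₁₃ F N θ p) (θ.Rz p.K) θ.τ9.M n
        (suppOfRecord₁₃SepCoP F N θ p n) (UbgOfRecord₁₃CoP F N θ p n) :=
  bgProvisoΛ_of_thm1RegSepCoP7MGB_of_thm1GaugeGB_of_hseam_of_powM θ hθ hRz h15 h15G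
    (fun p n => UbgMSCoPOfRecordB F N θ.ν θ.τ9.M (gOfRecord₁₃ F N θ p) p.K n)
    (fun p n s W => ubgMSCoPOfRecordB_dichotomy θ.ν θ.τ9.M (gOfRecord₁₃ F N θ p) p.K n s W) (fun p n => UbgOfRecord₁₃CoP_succ F N θ p n) hnum ha₀ hcomp hcomp' hBα htI htMS hsN hMa hC1 hM₁
    hadm hDat

end SocketsG

end Summit.QuantumFields.YangMills.Theorems.BalabanUVNodesN11BgRowGaugeSocketsOfPowMB

end
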